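import Mathlib
import HarnessLib
import Summits.NavierStokesRegularity.NavierStokesRegularity.Theses.PerpetualPump
import Literature.Analysis.FluidPDE.TaoCascadeModeDuhamel
import Literature.Analysis.FluidPDE.TaoAveragedCascade
import Literature.Analysis.FluidPDE.TaoAveragedCascadeReduction
import Literature.Barriers.NavierStokesRegularity.TruncatedDyadicBlowup

/-!
# Sketch — crux-ideate stmt-NavierStokesRegularity-1835 (AveragedTypeIBlowup), ideator 3, round 1

First-lemma signatures for three crux idea cards (no proofs; `Prop`-valued definitions only):

* `exact-volterra-embedding`      — `modeKernel`, `ExactVolterra`, `KernelScaling`, `ThinShellKernel`;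
* `viscous-comparator-gated-pump`  — `ClockIsThreshold`, `AmplifierInversion`, `GatedOvershootBound`;
* `coarse-lattice-thin-wavelets`   — `HasSymmBallSupport`, `coarseCascadeForm`, `CoarseCascadeIsAveraged`,
                                     `CoarseCascadeTypeIBlowup`, `CoarseToCrux`.
-/

noncomputable section

open MeasureTheory Set Filter Topology FourierTransform
open scoped SchwartzMap

namespace Summit.NavierStokesRegularity.NavierStokesRegularity.Cruxes.AveragedTypeIBlowup.Ideator3

open Literature.Analysis.FluidPDE.Tao2016
open Literature.Analysis.FluidPDE

local notation "ℝ³" => EuclideanSpace ℝ (Fin 3)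
local notation "ℂ³" => EuclideanSpace ℂ (Fin 3)

/-! ## Card 1: exact Volterra embedding -/

/-- The **mode kernel** `h_{i,n}(τ) = Re ⟨e^{τΔ} ψ_{i,n}, ψ_{i,n}⟩ = ∫ e^{-4π²τ|ξ|²} |ψ̂_{i,n}(ξ)|² dξ`
(completely monotone in `τ`; the Laplace transform of the spectral measure of `ψ_{i,n}` under `|ξ|²`). -/
def modeKernel {ε₀ : ℝ} {m : ℕ} (𝒟 : CascadeWaveletData ε₀ m) (i : Fin m) (n : ℤ) (τ : ℝ) : ℝ :=
  (pairing (heat τ (cascadeWavelet ε₀ (𝒟.ψ i) n)) (cascadeWavelet ε₀ (𝒟.ψ i) n)).re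

/-- **FIRST LEMMA of card 1 (exact Volterra identity, local in time).** For a mild solution on `[0,T)` of
the cascade equation `∂ₜu = Δu + C(u,u)` with datum `A ψ_{i₀,n₀}`, the mode coefficients
`X_{i,n}(t) = ⟨u(t), ψ_{i,n}⟩` satisfy EXACTLY (no error term) the closed Volterra system
`X_{i,n}(t) = A 1_{(i,n)=(i₀,n₀)} h_{i,n}(t) + ∫₀ᵗ h_{i,n}(t-s) F_{i,n}(X(s)) ds`, where the drive
`F_{i,n} = quadTermC` depends on `u(s)` only through the coefficients `⟨u(s), ψ_{j,k}⟩`.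
(In tree for global solutions and general band-limited test fields:
`IsMildSolutionFor.pairing_eq_of_isBandLimited`; here: `Ico 0 T`, `w = ψ_{i,n}`, scalar datum.) -/
def ExactVolterra : Prop :=
  ∀ (ε₀ : ℝ) (m : ℕ), 0 < ε₀ → ∀ (𝒟 : CascadeWaveletData ε₀ m)
    (α : Fin m → Fin m → Fin m → ℤ × ℤ × ℤ → ℝ) (i₀ : Fin m) (n₀ : ℤ) (A T : ℝ) (u : ℝ → L2C),
    IsMildSolutionFor (cascadeOperatorForm ε₀ 𝒟.ψ α) ((A : ℂ) • cascadeWavelet ε₀ (𝒟.ψ i₀) n₀) (Set.Ico 0 T) u →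
    ∀ (i : Fin m) (n : ℤ), ∀ t ∈ Set.Ico 0 T,
      modeCoeff 𝒟 u i n t =
        (if i = i₀ ∧ n = n₀ then A * modeKernel 𝒟 i n t else 0) +
          ∫ s in (0:ℝ)..t, modeKernel 𝒟 i n (t - s) * (quadTermC ε₀ 𝒟.ψ α (u s) i n).re

/-- **Kernel scale invariance**: `h_{i,n}(τ) = h_{i,0}((1+ε₀)^{2n} τ)` (dilation conjugates the heat flow). -/
def KernelScaling : Prop :=
  ∀ (ε₀ : ℝ) (m : ℕ), 0 < ε₀ → ∀ (𝒟 : CascadeWaveletData ε₀ m) (i : Fin m) (n : ℤ) (τ : ℝ), 0 ≤ τ →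
    modeKernel 𝒟 i n τ = modeKernel 𝒟 i 0 ((1 + ε₀) ^ (2 * n) * τ)

/-- **Thin-shell kernel shaping** (the design freedom): for every relative shell thickness `δ > 0` there are
wavelet data whose unit-scale kernels are sandwiched between two exponentials with rates `d` and `(1+δ)d`,
i.e. the exact Volterra system is an `O(δ)`-small fading-memory perturbation of the viscous circuit ODE
`Ẋ = -d N² X + F(X)`, with `δ` independent of `ε₀`. -/
def ThinShellKernel : Prop :=
  ∀ (δ ε₀ : ℝ) (m : ℕ), 0 < δ → 0 < ε₀ → ε₀ < 1 / 4 →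
    ∃ (𝒟 : CascadeWaveletData ε₀ m) (d : ℝ), 0 < d ∧
      ∀ (i : Fin m) (τ : ℝ), 0 ≤ τ →
        Real.exp (-((1 + δ) * d * τ)) ≤ modeKernel 𝒟 i 0 τ ∧ modeKernel 𝒟 i 0 τ ≤ Real.exp (-(d * τ))

/-! ## Card 2: viscous comparator gating the pump (Prop 5.1 made autonomous) -/

/-- **FIRST LEMMA of card 2 (Prop 5.1's exogenous clock is a THRESHOLD clock).** The endpoint (`δ = 1-2α`)
truncated dyadic chain of Tao's Prop. 5.1 can be taken with switching times `t_k` equal to the FIRST hitting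
times of the critical thresholds `λ^{-(1-2α)k}` by `X_k`, and it is Type-I bounded; i.e. the exogenously
clocked chain is the solution of the autonomous hybrid rule "top pair active until the receiver reaches its
critical threshold" (the singular limit of the viscous-comparator circuit). -/
def ClockIsThreshold : Prop :=
  ∀ lam α : ℝ, 1 < lam → 0 < α → α < 1 / 2 →
    ∃ (n₀ : ℕ) (t : ℕ → ℝ) (Tstar : ℝ) (X : ℕ → ℝ → ℝ),
      t 0 = 0 ∧ StrictMono t ∧ (∀ k, t k < Tstar) ∧ Tendsto t atTop (𝓝 Tstar) ∧
      (∀ k, ContinuousOn (X k) (Ico 0 Tstar)) ∧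
      (∀ k, ∀ s ∈ Ico 0 Tstar, s ∉ range t →
        HasDerivAt (X k)
          (Literature.Barriers.NavierStokesRegularity.TruncatedDyadic.truncRHS lam α n₀ t X k s) s) ∧
      (∀ k : ℕ, X k (t k) = lam ^ (-((1 - 2 * α) * k))) ∧
      (∀ k : ℕ, ∀ s, 0 ≤ s → s < t k → X k s < lam ^ (-((1 - 2 * α) * k))) ∧
      (∃ C : ℝ, ∀ k, ∀ s ∈ Ico 0 Tstar, lam ^ ((1 - 2 * α) * ((n₀ + k : ℕ) : ℝ)) * |X k s| ≤ C)

/-- **Amplifier inversion law (why the amplifier cannot serve as a CLAMP; a negative first lemma).** For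
the inviscid fast-pulse limit of Tao's amplifier gadget run at its viscous threshold, `A' = -Z²`,
`Z' = κ (A - ρ) Z` (`κ > 0` the comparator stiffness), the quantity `Z² + κ (A - ρ)²` is conserved; hence a
pulse started at `A(0) = a₀ > ρ` with a small seed ends at `A_f = 2ρ - a₀`: the live amplitude is INVERTED about
the threshold (slope `-1`), for every stiffness `κ` — so "clamp by eating the excess" is dead and the gate must
act on the TRANSFER (kill the pump), not on the amplitude. -/
def AmplifierInversion : Prop :=
  ∀ (κ ρ : ℝ) (A Z : ℝ → ℝ), 0 < κ →
    (∀ s, 0 ≤ s → HasDerivAt A (-(Z s) ^ 2) s) →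
    (∀ s, 0 ≤ s → HasDerivAt Z (κ * (A s - ρ) * Z s) s) →
    ∀ s, 0 ≤ s → Z s ^ 2 + κ * (A s - ρ) ^ 2 = Z 0 ^ 2 + κ * (A 0 - ρ) ^ 2

/-- **Gated transfer stage: overshoot bound (the quantitative heart of the attracting return map).** One hop in
critical units: giver `A`, receiver `B` (level clock `q²`), pump catalyst `R` (rotor `A ↔ B` at angular rate
`P R`), hot-detector `Z` on the receiver (speed `d`, absolute threshold `θ`, seed `ζ`), blocker gain `c`:
`A' = -A - P R B`, `B' = q² (-B) + P R A`, `R' = -R - c Z R`, `Z' = q² d (B/θ - 1) Z`.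
Conclusion: the receiver never exceeds `θ (1 + K (P R(0) A(0)/θ) (1 + log (1/ζ)) / d)` — the overshoot is
controlled by (pump flux at crossing)/(detector speed), uniformly in the blocker gain `c ≥ c₀`; together with
"B reaches θ whenever the incoming parcel is hot enough" this makes the hop's output `θ (1 + small)`, i.e. a
return map of elasticity `< 1` (attracting fixed point), cf. `ClockIsThreshold` for the stiff limit. -/
def GatedOvershootBound : Prop :=
  ∀ (q θ d P c₀ ζ : ℝ), 1 < q → 0 < θ → 0 < d → 0 < P → 0 < c₀ → 0 < ζ → ζ < 1 →
    ∃ K : ℝ, 0 < K ∧ ∀ (c a₀ r₀ : ℝ), c₀ ≤ c → 0 < a₀ → 0 < r₀ →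
      ∀ (A B R Z : ℝ → ℝ), A 0 = a₀ → B 0 = 0 → R 0 = r₀ → Z 0 = ζ →
        (∀ s, 0 ≤ s → HasDerivAt A (-A s - P * R s * B s) s) →
        (∀ s, 0 ≤ s → HasDerivAt B (q ^ 2 * (-B s) + P * R s * A s) s) →
        (∀ s, 0 ≤ s → HasDerivAt R (-R s - c * Z s * R s) s) →
        (∀ s, 0 ≤ s → HasDerivAt Z (q ^ 2 * d * (B s / θ - 1) * Z s) s) →
        ∀ s, 0 ≤ s → B s ≤ θ * (1 + K * (P * r₀ * a₀ / θ) * (1 + Real.log (1 / ζ)) / d)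

/-! ## Card 3: coarse lattice, thin wavelets -/

/-- A real Schwartz profile with Fourier support in the symmetric pair of balls `B(c, r) ∪ -B(c, r)`. -/
def HasSymmBallSupport (c : ℝ³) (r : ℝ) (ψ : 𝓢(ℝ³, ℝ³)) : Prop :=
  ∀ ξ : ℝ³, ξ ∉ Metric.ball c r → -ξ ∉ Metric.ball c r →
    𝓕 (Literature.Analysis.FunctionSpaces.EuclideanSpace.complexify ∘ ⇑ψ) ξ = 0

/-- **Coarse cascade form**: Tao's (4.1) with the fine scale ratio `1+ε₀` replaced by an arbitrary lattice
ratio `q > 1` (`ψ_{i,n} = Dil_{qⁿ} ψᵢ`, coefficient `q^{5n/2}`), structure constants and shifts as in (4.1). -/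
def coarseCascadeForm (q : ℝ) {m : ℕ} (ψ : Fin m → 𝓢(ℝ³, ℝ³))
    (α : Fin m → Fin m → Fin m → ℤ × ℤ × ℤ → ℝ) (u v w : L2C) : ℂ :=
  ∑ i₁, ∑ i₂, ∑ i₃, ∑ μ ∈ TaoCascade.shiftSet, (α i₁ i₂ i₃ μ : ℂ) *
    ∑' n : ℤ, (((q ^ ((5 : ℝ) * (n : ℝ) / 2)) : ℝ) : ℂ) *
      (pairing u (dil (q ^ (n + μ.1)) (schwartzL2 (ψ i₁))) *
        pairing v (dil (q ^ (n + μ.2.1)) (schwartzL2 (ψ i₂))) *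
          pairing w (dil (q ^ (n + μ.2.2)) (schwartzL2 (ψ i₃))))

/-- **FIRST LEMMA of card 3 (coarse lattice, thin wavelets are averaged Euler operators).** Theorem 3.2 with
the dyadic LATTICE ratio `q ∈ (1, 2]` decoupled from the wavelet THINNESS `ε₀ ≤ ε₁`: profiles supported in
balls of radius `ε₀³` about centres of norm in `[1, 2]` (any finitely many, no annulus condition tying them to
`q`), on the lattice `qⁿ`. Proof expected = the tree's proof of `localCascade_isAveraged` with the per-slot
normalising dilations (§3.2 ¶2, Remark 3.5) allowed ratio `≤ 4` instead of `√2/(1-2ε₀)`. -/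
def CoarseCascadeIsAveraged : Prop :=
  ∃ ε₁ : ℝ, 0 < ε₁ ∧ ∀ ε₀ : ℝ, 0 < ε₀ → ε₀ ≤ ε₁ → ∀ q : ℝ, 1 + ε₀ ≤ q → q ≤ 2 →
    ∀ (m : ℕ) (ψ : Fin m → 𝓢(ℝ³, ℝ³)) (c : Fin m → ℝ³)
      (α : Fin m → Fin m → Fin m → ℤ × ℤ × ℤ → ℝ),
      (∀ i, 1 ≤ ‖c i‖ ∧ ‖c i‖ ≤ 2) → (∀ i, HasSymmBallSupport (c i) (ε₀ ^ 3) (ψ i)) →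
        ∃ 𝒜 : AveragingDatum, ∀ u v w, MemH10df u → MemH10df v → MemH10dfC w →
          𝒜.form u v w = coarseCascadeForm q ψ α u v w

/-- **The easier crux `C⁺` (first conjunct): Type-I blow-up for a COARSE cascade equation.** Same shape as
the crux, with `𝒜.form` replaced by an explicit symmetric cancelling coarse cascade form `q ≤ 2`; its dynamics
is the exact coarse Volterra chain of card 1, with `O(1)` critical gain `√q` per hop. -/
def CoarseCascadeTypeIBlowup : Prop :=
  ∃ (ε₀ q : ℝ) (m : ℕ) (ψ : Fin m → 𝓢(ℝ³, ℝ³)) (c : Fin m → ℝ³)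
    (α : Fin m → Fin m → Fin m → ℤ × ℤ × ℤ → ℝ),
    0 < ε₀ ∧ 1 + ε₀ ≤ q ∧ q ≤ 2 ∧ (∀ i, 1 ≤ ‖c i‖ ∧ ‖c i‖ ≤ 2) ∧
    (∀ i, HasSymmBallSupport (c i) (ε₀ ^ 3) (ψ i)) ∧
    (∀ u v w, MemH10df u → MemH10df v → MemH10df w →
      coarseCascadeForm q ψ α u v w = coarseCascadeForm q ψ α v u w) ∧
    (∀ u, MemH10df u → coarseCascadeForm q ψ α u u u = 0) ∧
    ∃ u₀ : 𝓢(ℝ³, ℝ³), VectorCalculus.IsDivFree ⇑u₀ ∧ ∃ T : ℝ, 0 < T ∧ ∃ u : ℝ → L2C,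
      IsMildSolutionFor (coarseCascadeForm q ψ α) (schwartzL2 u₀) (Set.Ico 0 T) u ∧
      (∃ M : ℝ, ∀ t ∈ Set.Ico 0 T, eLpNorm (u t) ⊤ volume ≤ ENNReal.ofReal (M / Real.sqrt (T - t))) ∧
      ¬ ∃ T' : ℝ, T < T' ∧ ∃ v : ℝ → L2C,
        IsMildSolutionFor (coarseCascadeForm q ψ α) (schwartzL2 u₀) (Set.Ico 0 T') v ∧ ∀ t ∈ Set.Ico 0 T, v t = u t

/-- **TRANSFER of card 3**: `C⁺ := CoarseCascadeTypeIBlowup ∧ CoarseCascadeIsAveraged (at the chosen ε₀)`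
implies the crux (bookkeeping as in the tree's Thm 1.5 ⇐ Thm 3.2 + Thm 3.3: the mild identity only evaluates
the form on `H¹⁰_df` arguments). -/
def CoarseToCrux : Prop :=
  CoarseCascadeIsAveraged → CoarseCascadeTypeIBlowup →
    Summit.NavierStokesRegularity.NavierStokesRegularity.Theses.PerpetualPump.AveragedTypeIBlowup

end Summit.NavierStokesRegularity.NavierStokesRegularity.Cruxes.AveragedTypeIBlowup.Ideator3
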